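import Mathlib
import HarnessLib
import Summits.ValiantsHypothesis.ValiantsHypothesis.Theses.MonotoneRestoration
import Literature.Computability.AlgebraicComplexity.ArithCircuit
import Literature.Computability.AlgebraicComplexity.ArithCircuitProofs
import Literature.Computability.AlgebraicComplexity.MonotoneStructure
import Literature.Computability.AlgebraicComplexity.PermanentIrreducible
import Literature.ModelTheory.FiniteModelTheory.CkEquiv
import Summits.ValiantsHypothesis.ValiantsHypothesis.Theorems.MonotoneRestorationMonotoneRestorationQPCosetCount
import Summits.ValiantsHypothesis.ValiantsHypothesis.Theorems.MonotoneRestorationMonotoneRestorationQPSymmetricLB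
import Summits.ValiantsHypothesis.ValiantsHypothesis.Theorems.MonotoneRestorationMonotoneRestorationQPSupportSymmetrisation
import Summits.ValiantsHypothesis.ValiantsHypothesis.Theorems.MonotoneRestorationMonotoneRestorationQPSparseRegime
import Summits.ValiantsHypothesis.ValiantsHypothesis.Theorems.MonotoneRestorationMonotoneRestorationQPBeta
import Literature.Computability.AlgebraicComplexity.SymmetricArithCircuit
import Literature.Computability.AlgebraicComplexity.DawarWilsenach2025Proofs
import Literature.GroupTheory.PermutationGroups.SmallIndexSubgroups
import Summits.ValiantsHypothesis.ValiantsHypothesis.Theorems.MonotoneRestorationQP.Negative.LoadBearing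
import Summits.ValiantsHypothesis.ValiantsHypothesis.Theorems.MonotoneRestorationMonotoneRestorationQPPermSupportCount

/-! # TTRL-lite variant V22331 of `MonotoneRestorationQP` / `stub_gammaArithmetic` (stmt-ValiantsHypothesis-15886)

Machine-generated helper (refuted variant); move `lemma_proposal`, op `llm`: Boundary probe, expected FALSE and decidable (bounded quantifiers): ratio 7/10 > ln 2 must eventually fail and the FIRST failure is exactly (m, d) = (60, 42) (61^42 > 2*60^42; every other pair in the .
See docs/architecture/ttrl-lite.md. -/

namespace Summit.ValiantsHypothesis.ValiantsHypothesis.Theorems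

open Summit.ValiantsHypothesis.ValiantsHypothesis.Theses.MonotoneRestoration
open Literature.Computability.AlgebraicComplexity

/-- TTRL-lite variant V22331 (lemma_proposal `llm`) of `stub_gammaArithmetic` (stmt-ValiantsHypothesis-15886); machine-found, kernel-checked. -/
theorem stub_gammaArithmetic_var22331_false :
    ¬ (∀ m : ℕ, m ≤ 60 → ∀ d : ℕ, d ≤ 42 → 10 * d ≤ 7 * m → (m + 1) ^ d ≤ 2 * m ^ d) := by
  decide

end Summit.ValiantsHypothesis.ValiantsHypothesis.Theorems
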